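import Literature.MathematicalPhysics.QuantumFieldTheory.Balaban1983to89.B3Sect1TwoPoint

/-!
# `Balaban1983to89.B3Eq124OneSidedBridge` — T. Bałaban, *(Higgs)₂,₃ quantum fields in a finite volume. III.
Renormalization*, Commun. Math. Phys. **88** (1983) 411–445 [Balaban1983Higgs3], (1.24) p. 417: **the bridge between the
vacuum-energy counterterm `E₁` of (1.24) IN ITS REPAIRED, ONE-SIDED READING (`B3Sect1TwoPoint.E1of124R` = r01's
`B1Sect1Statements.ModelData.e1R`, right `λ`-derivatives at `0⁺`) and r12's ONE-SIDED double Taylor sum (I.3.62)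
`B1Sect3Statements.pertSum362R`** — the one-sided twin of r15's `B3Sect1TwoPoint.e1_eq_pertSum362_sub`; theorems only

statement-level skeleton of published theorems with citation tags; proofs where landed; nothing here is a claim about the Yang–Mills mass gap

PDFs held: `paper:balaban1983-higgs-2-3-quantum-fields-finite-volume` (journal page = PDF page + 410) and
`paper:balaban1982-cmp85-higgs23-i` (journal page = PDF page + 602).  (1.24) read on the ×2 render
`run/shared/lean/pub/pub-balaban/b2b-balaban-ref1/pages/1983-cmp88-higgs23-III/1983-cmp88-higgs23-III-p007-x2.png`
(p. 417), (I.3.62) on `…/1982-cmp85-higgs23-I/1982-cmp85-higgs23-I-p022-x2.png` (p. 624).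

CITATION HEADER (lean-in-tree rule).  lit-balaban typed skeleton (HOME `run/shared/lean/pub/lit-balaban/`), typer line;
located member of SKELETON row **B3.Eq1.24** (owner r15, `typed-existing`; r15's `B3-CLOSURE.md` §3(f): *«the bridge
`e1_eq_pertSum362_sub` stays on the two-sided located objects until r12 lands a one-sided `pertSum362R`»* — r12's
`pertSum362R` HAS landed (v1.1 of `B1Sect3Statements`), and this file supplies the one-sided bridge; cells only).  THE
SOURCE TEXT, p. 417 [PDF 7], verbatim: *"E₁ = Σ_{1≦α+β≦n̄} (1/(α!β!)) e^αλ^β (∂^{α+β}/∂e^α∂λ^β log∫dA∫dφ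
e^{−S^ε(A,φ)})|_{e=λ=0} (1.24)"*; paper I p. 624 [PDF 22], (3.62): *"S^{(k+1),L^{k+1}ε}(B, ψ) = Σ_{0≦α+β≦n̄} (1/(α!β!))
e^αλ^β (∂^{α+β}/∂e′^α∂λ′^β E(e′, λ′, B, ψ))|_{e′=λ′=0}"*.  READING (the semantic audit of the typer g24,
`B1Eq113OneSidedDerivatives`, and the owners' repairs r01 p331274 / r12 / r15 p332000): the `λ`-derivatives are RIGHT
derivatives at `λ = 0⁺` (`iteratedDerivWithin β · (Set.Ici 0) 0`) in both declarations of record, the `e`-derivatives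
two-sided.

WHAT IS PROVED (0 sorry; theorems only; nothing re-declared).
* **`E1of124R_eq_pertSum362R_sub`**: `E₁ = pertSum362R (log Z^ε) e λ n̄ − log Z^ε(0, 0)` — (1.24) is (I.3.62) without its
  `(α, β) = (0, 0)` term, at the generating function `log Z^ε` and the model's couplings (the one-sided twin of r15's
  `e1_eq_pertSum362_sub`, same bookkeeping).
* `E1of124R_congr_Ici`: the repaired `E₁` depends on `log Z^ε(e′, λ′)` ONLY through its values on the physical half-plane
  `λ′ ≥ 0` (r12's `pertSum362R_congr_Ici`) — the point of the repair (the functional integral diverges for `λ′ < 0`).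
* `E1of124R_eq_E1of124`: under two-sided smoothness of `λ′ ↦ log Z^ε(e′, λ′)` at `0` up to order `n̄` for every `e′` the
  repaired and the located two-sided `E₁` agree (r12's `pertSum362R_eq_pertSum362` through the two bridges).
HONEST SCOPE.  Bookkeeping identities between declarations of record; no smoothness of `log Z^ε` is asserted (it is the
hypothesis of the third theorem).  Unit `lit-balaban-typer` gen 30 (literature-prover-lit-balaban-typer-g30-0);
HOME/FILED.md records the proposal.
-/

open scoped BigOperators

namespace Literature.MathematicalPhysics.QuantumFieldTheory.Balaban1983to89.B3Eq124OneSidedBridge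

open Literature.MathematicalPhysics.QuantumFieldTheory.Balaban1983to89.B1Sect1Statements
open Literature.MathematicalPhysics.QuantumFieldTheory.Balaban1983to89.B3Sect1TwoPoint

variable (D : ModelData) (P : HiggsLattice.Params)

/-- **(1.24) one-sided = (I.3.62) one-sided minus its constant term**: `E₁ = pertSum362R (log Z^ε) e λ n̄ − log Z^ε(0, 0)`
for the declarations of record `B3Sect1TwoPoint.E1of124R` (= r01's `ModelData.e1R`) and r12's
`B1Sect3Statements.pertSum362R` (the `(0,0)` term of the full one-sided Taylor polynomial is the value at zero couplings:
`iteratedDerivWithin 0 = id`). PROVED. [cite: Balaban1983Higgs3, (1.24) p.417] -/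
theorem E1of124R_eq_pertSum362R_sub :
    E1of124R D P = B1Sect3Statements.pertSum362R (D.logZ P) D.C.e D.lam D.nbar - D.logZ P 0 0 := by
  -- the common one-sided Taylor term of (1.24) and (I.3.62)
  set T : ℕ → ℕ → ℝ := fun α β =>
    1 / ((Nat.factorial α : ℝ) * (Nat.factorial β : ℝ)) * D.C.e ^ α * D.lam ^ β *
      iteratedDeriv α (fun e' => iteratedDerivWithin β (fun lam' => D.logZ P e' lam') (Set.Ici 0) 0) 0 with hT
  set s : Finset (ℕ × ℕ) := Finset.range (D.nbar + 1) ×ˢ Finset.range (D.nbar + 1) with hs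
  have hL : E1of124R D P = ∑ ab ∈ s, (if 1 ≤ ab.1 + ab.2 ∧ ab.1 + ab.2 ≤ D.nbar then T ab.1 ab.2 else 0) := by
    rw [E1of124R_eq_sum, hs, Finset.sum_product' (f := fun a b => if 1 ≤ a + b ∧ a + b ≤ D.nbar then T a b else 0)]
  have hR : B1Sect3Statements.pertSum362R (D.logZ P) D.C.e D.lam D.nbar
      = ∑ ab ∈ s, (if ab.1 + ab.2 ≤ D.nbar then T ab.1 ab.2 else 0) := by
    rw [B1Sect3Statements.pertSum362R, Finset.sum_filter]
  rw [hL, hR]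
  have h0 : ((0 : ℕ), (0 : ℕ)) ∈ s := by simp [hs]
  rw [← Finset.sum_erase_add _ _ h0,
    ← Finset.sum_erase_add s (fun ab => if ab.1 + ab.2 ≤ D.nbar then T ab.1 ab.2 else 0) h0]
  have hsum : ∑ ab ∈ s.erase (0, 0), (if 1 ≤ ab.1 + ab.2 ∧ ab.1 + ab.2 ≤ D.nbar then T ab.1 ab.2 else 0)
      = ∑ ab ∈ s.erase (0, 0), (if ab.1 + ab.2 ≤ D.nbar then T ab.1 ab.2 else 0) := by
    refine Finset.sum_congr rfl fun ab hab => ?_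
    have hne : ab ≠ (0, 0) := (Finset.mem_erase.mp hab).1
    have h1 : 1 ≤ ab.1 + ab.2 := by
      by_contra hlt
      apply hne
      ext <;> simp <;> omega
    simp [h1]
  have hT0 : T 0 0 = D.logZ P 0 0 := by simp [hT]
  rw [hsum]
  simp [hT0]

/-- **The repaired `E₁` sees `log Z^ε` only on the physical half-plane `λ′ ≥ 0`**: two generating functions agreeing for
all `e′` and all `λ′ ≥ 0` give the same one-sided (I.3.62) sum, hence (by `E1of124R_eq_pertSum362R_sub`) the same `E₁` —
whatever values `log Z^ε` carries on `λ′ < 0`, where the functional integral diverges (typer g24's audit). From r12's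
`pertSum362R_congr_Ici`. [cite: Balaban1983Higgs3, (1.24) p.417] -/
theorem E1of124R_congr_Ici {F : ℝ → ℝ → ℝ} (h : ∀ e' l', 0 ≤ l' → D.logZ P e' l' = F e' l') :
    E1of124R D P = B1Sect3Statements.pertSum362R F D.C.e D.lam D.nbar - F 0 0 := by
  rw [E1of124R_eq_pertSum362R_sub, B1Sect3Statements.pertSum362R_congr_Ici h, h 0 0 le_rfl]

/-- **Agreement of the two readings of (1.24) under two-sided smoothness**: if for every `e′` the function
`λ′ ↦ log Z^ε(e′, λ′)` is `C^β` at `λ′ = 0` (two-sidedly) for all `β ≦ n̄`, the repaired `E1of124R` equals the located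
two-sided `E1of124` (r12's `pertSum362R_eq_pertSum362` through the two bridges `E1of124R_eq_pertSum362R_sub` and r15's
`e1_eq_pertSum362_sub`). [cite: Balaban1983Higgs3, (1.24) p.417] -/
theorem E1of124R_eq_E1of124 (h : ∀ e', ∀ β ≤ D.nbar, ContDiffAt ℝ β (fun l' => D.logZ P e' l') 0) :
    E1of124R D P = E1of124 D P := by
  rw [E1of124R_eq_pertSum362R_sub, e1_eq_pertSum362_sub, B1Sect3Statements.pertSum362R_eq_pertSum362 h]

end Literature.MathematicalPhysics.QuantumFieldTheory.Balaban1983to89.B3Eq124OneSidedBridge
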